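import Literature.AlgebraicGeometry.HodgeTheory.HodgeGenericQbarDescentProofs
import Literature.ModelTheory.ExponentialFields.DefinableAlgebraicNumbersProofs
import Literature.Barriers.Schanuel.AxiomsDoNotForceSchanuelProofs
import HarnessLib

/-!
# Ring 2 transport — descent of `Aut(ℂ/ℚ)`-stable spaces of endomorphisms to `ℚ` (junction
`DeligneMilne1982_Thm_6_20_full → HodgeGroupH1CommutantSpan`, part A of 3: pure algebra)

research route conditional on HC_CM; not a corollary; Q11.4-sentence-2 already refuted in dim ≥ 3.

Cell `pub-hodge-ring2`, seat `transport`, gen 52; helper file riding `--supports` the umbrella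
`Theses.RankFourFaces.CMToAbelian` (LEAD ruling L41.7 (1): the junction `DeligneMilne1982_Thm_6_20_full → R`
is an EDGE in a transport file). This part is the field-theoretic input of Deligne's sentence «the
commutant of `Hg(A)` in `End(H¹(A, ℚ))` is `End⁰(A)`» read over `ℂ` (LNM 900, I §3 Prop. 3.4 and I §5 proof of
Prop. 5.1): a `ℂ`-subspace of `End_ℂ(V)` which is stable under the entrywise action of `Aut(ℂ/ℚ)` in a
basis is spanned by its elements with RATIONAL entries. Nothing here is specific to cohomology.

WHAT IS PROVED (theorems only: no `sorry`, no new axiom, no named fact, no `def`):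
* `mem_span_ratEntries_of_stable` — endomorphism form of the tree's PROVED Galois descent
  `mem_span_fixedCoord_of_stable` (Lang, *Introduction to Algebraic Geometry*, III §2 Thm. 7: an
  automorphism-stable subspace is spanned by vectors with coordinates in the fixed field), for any fields
  `K ⊆ C` whose `Aut(C/K)`-fixed elements lie in `K`;
* `mem_range_algebraMap_rat_of_forall_algEquiv` — **the fixed field of `Aut(ℂ)` is `ℚ`**: a transcendental
  `c` is moved (to `-c`) and an algebraic irrational `c` is moved by an automorphism of `ℚ̄ ⊂ ℂ` (Galois theory,
  Mathlib `InfiniteGalois.mem_bot_iff_fixed`) extended to `ℂ` — both extensions by the tree's PROVED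
  `KMO2012.exists_ringEquiv_extend` (transcendence bases + uniqueness of algebraic closures; a
  transcendental complex number from the tree's `Literature.Barriers.Schanuel.exists_transcendental_complex`);
* `exists_eq_baseChange_of_ratEntries` — an endomorphism of `C ⊗_K V₀` with entries in `K` in a basis
  `1 ⊗ bᵢ` is the base change of a `K`-endomorphism of `V₀`.

References: S. Lang, *Introduction to Algebraic Geometry* (1958), Ch. III §2 Thm. 7 [Lang1958IAG];
P. Deligne, *Hodge cycles on abelian varieties*, LNM 900 (1982), I §3 Prop. 3.4, I §5 Prop. 5.1
[Deligne1982HodgeCycles].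
-/

set_option linter.dupNamespace false

noncomputable section

open scoped TensorProduct
open Module

namespace Summit.HodgeConjecture.HodgeConjecture.Ring2Transport.Descent

universe u v w

/-! ## §A1 Entrywise descent for spaces of endomorphisms -/

section EndDescent

variable {K : Type u} {C : Type v} [Field K] [Field C] [Algebra K C]
  {V : Type w} [AddCommGroup V] [Module C V] {ι : Type*} [Fintype ι]

/-- **Entrywise Galois descent for spaces of endomorphisms** (Lang III §2 Thm. 7, endomorphism form). Let
`K ⊆ C` be fields such that every element of `C` fixed by all `K`-automorphisms of `C` lies in `K`,
`e` a finite `C`-basis of `V`, and `W ⊆ End_C(V)` a subspace such that for every `τ ∈ Aut(C/K)` and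
`x ∈ W` some `x' ∈ W` has entries `τ(x_{ij})`. Then `W` is spanned by its elements all of whose entries lie
in `K`. (The tree's `mem_span_fixedCoord_of_stable` applied to the entries.) [cite: Lang1958IAG, Ch. III §2, Thm. 7] -/
theorem mem_span_ratEntries_of_stable
    (hfix : ∀ c : C, (∀ τ : C ≃ₐ[K] C, τ c = c) → c ∈ Set.range (algebraMap K C))
    (e : Basis ι C V) (W : Submodule C (V →ₗ[C] V))
    (hW : ∀ τ : C ≃ₐ[K] C, ∀ x ∈ W, ∃ x' ∈ W,
      ∀ i j, e.repr (x' (e j)) i = τ (e.repr (x (e j)) i)) :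
    ∀ x ∈ W, x ∈ Submodule.span C
      {x' | x' ∈ W ∧ ∀ i j, e.repr (x' (e j)) i ∈ Set.range (algebraMap K C)} := by
  classical
  intro x hx
  -- the entries of an endomorphism, as a finitely supported function on `ι × ι`
  let entries : (V →ₗ[C] V) →ₗ[C] (ι × ι →₀ C) :=
    (Finsupp.linearEquivFunOnFinite C C (ι × ι)).symm.toLinearMap ∘ₗ
      { toFun := fun x p => e.repr (x (e p.2)) p.1
        map_add' := fun x y => by
          funext p
          simp only [LinearMap.add_apply, map_add, Finsupp.add_apply, Pi.add_apply]
        map_smul' := fun c x => by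
          funext p
          simp only [LinearMap.smul_apply, map_smul, Finsupp.smul_apply, Pi.smul_apply,
            RingHom.id_apply] }
  have entries_apply : ∀ (x : V →ₗ[C] V) (p : ι × ι), entries x p = e.repr (x (e p.2)) p.1 := by
    intro x p
    simp only [entries, LinearMap.coe_comp, LinearEquiv.coe_coe, Function.comp_apply,
      LinearMap.coe_mk, AddHom.coe_mk, Finsupp.linearEquivFunOnFinite_symm_apply]
  have entries_injective : Function.Injective entries := by
    intro x y h
    refine e.ext fun j => e.repr.injective (Finsupp.ext fun i => ?_)
    have := DFunLike.congr_fun h (i, j)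
    rwa [entries_apply, entries_apply] at this
  -- the coordinate image of `W` is `Aut(C/K)`-stable
  have hstab : ∀ τ : C ≃ₐ[K] C, ∀ v ∈ W.map entries,
      Finsupp.mapRange τ (map_zero τ) v ∈ W.map entries := by
    rintro τ _ ⟨y, hy, rfl⟩
    obtain ⟨y', hy', hyy'⟩ := hW τ y hy
    refine ⟨y', hy', Finsupp.ext fun p => ?_⟩
    rw [Finsupp.mapRange_apply, entries_apply, entries_apply, hyy']
  have hmem := Literature.AlgebraicGeometry.HodgeTheory.mem_span_fixedCoord_of_stable hfix
    (W.map entries) hstab (entries x) ⟨x, hx, rfl⟩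
  -- the fixed-coordinate vectors of the image come from the rational-entry elements of `W`
  have hsub : {u | u ∈ W.map entries ∧ ∀ p, u p ∈ Set.range (algebraMap K C)} ⊆
      entries '' {x' | x' ∈ W ∧ ∀ i j, e.repr (x' (e j)) i ∈ Set.range (algebraMap K C)} := by
    rintro _ ⟨⟨y, hy, rfl⟩, hu⟩
    refine ⟨y, ⟨hy, fun i j => ?_⟩, rfl⟩
    have := hu (i, j)
    rwa [entries_apply] at this
  have hmem' := Submodule.span_mono hsub hmem
  rw [← Submodule.map_span] at hmem'
  obtain ⟨y, hy, hyx⟩ := Submodule.mem_map.1 hmem'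
  rwa [← entries_injective hyx]

end EndDescent

/-! ## §A2 The fixed field of `Aut(ℂ)` is `ℚ` -/

section FixedField

/-- **The fixed field of `Aut(ℂ/ℚ) = Aut(ℂ)` is `ℚ`.** A complex number fixed by every `ℚ`-algebra
automorphism of `ℂ` is rational: a transcendental `c` is moved to `-c` by an automorphism (extend
`X_c ↦ -X_c` from a purely transcendental subalgebra through a transcendence basis containing `c`,
`KMO2012.exists_ringEquiv_extend`); an algebraic irrational `c ∈ ℚ̄` is moved by some `ρ ∈ Gal(ℚ̄/ℚ)`
(Mathlib `InfiniteGalois.mem_bot_iff_fixed`), and `ρ` extends to `ℂ` (same lemma). This is the input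
«`{σμ | σ ∈ Aut(ℂ)}` … defined over `ℚ`» of Deligne I §3 (proof of Prop. 3.4) on the tree's carriers. [folklore] -/
theorem mem_range_algebraMap_rat_of_forall_algEquiv {c : ℂ} (hc : ∀ τ : ℂ ≃ₐ[ℚ] ℂ, τ c = c) :
    c ∈ Set.range (algebraMap ℚ ℂ) := by
  classical
  -- ring automorphisms of `ℂ` are `ℚ`-algebra automorphisms
  have hc' : ∀ ψ : ℂ ≃+* ℂ, ψ c = c := fun ψ =>
    hc (AlgEquiv.ofRingEquiv (f := ψ) fun q => by
      rw [eq_ratCast (algebraMap ℚ ℂ) q]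
      exact map_ratCast ψ q)
  by_contra hnot
  by_cases halg : IsAlgebraic ℚ c
  · -- algebraic irrational
    have hcE : c ∈ algebraicClosure ℚ ℂ := mem_algebraicClosure_iff.2 halg
    haveI : IsAlgClosure ℚ (algebraicClosure ℚ ℂ) := algebraicClosure.isAlgClosure ℚ ℂ
    haveI : Algebra.IsAlgebraic ℚ (algebraicClosure ℚ ℂ) := algebraicClosure.isAlgebraic ℚ ℂ
    haveI : IsGalois ℚ (algebraicClosure ℚ ℂ) := isGalois_iff.2 ⟨inferInstance, inferInstance⟩
    have hρ : ∃ ρ : algebraicClosure ℚ ℂ ≃ₐ[ℚ] algebraicClosure ℚ ℂ, ρ ⟨c, hcE⟩ ≠ ⟨c, hcE⟩ := by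
      by_contra! h
      apply hnot
      obtain ⟨q, hq⟩ := IntermediateField.mem_bot.1 ((InfiniteGalois.mem_bot_iff_fixed _).2 h)
      refine ⟨q, ?_⟩
      have hq' := congrArg (fun z : algebraicClosure ℚ ℂ => (z : ℂ)) hq
      simp only at hq'
      rw [← hq']
      exact IsScalarTower.algebraMap_apply ℚ (algebraicClosure ℚ ℂ) ℂ q
    obtain ⟨ρ, hρ⟩ := hρ
    obtain ⟨τ, hτ⟩ := Literature.Barriers.Schanuel.exists_transcendental_complex
    obtain ⟨ψ, hψE, -⟩ :=
      Literature.ModelTheory.ExponentialFields.KMO2012.exists_ringEquiv_extend ρ hτ (ε := 1) (one_mul 1)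
    apply hρ
    apply Subtype.ext
    have h1 := hψE ⟨c, hcE⟩
    rw [hc' ψ] at h1
    exact h1.symm
  · -- transcendental
    obtain ⟨ψ, -, hψc⟩ := Literature.ModelTheory.ExponentialFields.KMO2012.exists_ringEquiv_extend
      (F := ℂ) AlgEquiv.refl (show Transcendental ℚ c from halg) (ε := -1) (by norm_num)
    have h0 : c ≠ 0 := fun h => halg (h ▸ isAlgebraic_zero)
    rw [hc' ψ, map_neg, map_one, neg_one_mul] at hψc
    exact h0 (add_self_eq_zero.1 (eq_neg_iff_add_eq_zero.1 hψc))

/-- The same with ring automorphisms: a complex number fixed by `Aut(ℂ)` is rational. [folklore] -/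
theorem mem_range_algebraMap_rat_of_forall_ringEquiv {c : ℂ} (hc : ∀ ψ : ℂ ≃+* ℂ, ψ c = c) :
    c ∈ Set.range (algebraMap ℚ ℂ) :=
  mem_range_algebraMap_rat_of_forall_algEquiv fun τ => hc τ.toRingEquiv

end FixedField

/-! ## §A3 Rational entries ⟹ base change of a rational endomorphism -/

section BaseChange

variable {K : Type u} {C : Type v} [Field K] [Field C] [Algebra K C]
  {V₀ : Type w} [AddCommGroup V₀] [Module K V₀]
  {V : Type*} [AddCommGroup V] [Module C V] {ι : Type*} [Fintype ι] [DecidableEq ι]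

/-- **An endomorphism with entries in `K` is a base change.** For a `K`-basis `b` of `V₀`, an identification
`β : C ⊗_K V₀ ≃ V` and the `C`-basis `eᵢ = β(1 ⊗ bᵢ)` of `V`: if all entries of `x : End_C(V)` in `e` lie in
`K`, then `x ∘ β = β ∘ (x₀ ⊗ C)` for a `K`-endomorphism `x₀` of `V₀` (the one with the same matrix in `b`).
[folklore] -/
theorem exists_eq_baseChange_of_ratEntries (b : Basis ι K V₀) (β : C ⊗[K] V₀ ≃ₗ[C] V)
    (x : V →ₗ[C] V)
    (hx : ∀ i j, ((Algebra.TensorProduct.basis C b).map β).repr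
      (x (((Algebra.TensorProduct.basis C b).map β) j)) i ∈ Set.range (algebraMap K C)) :
    ∃ x₀ : V₀ →ₗ[K] V₀, ∀ t, x (β t) = β (x₀.baseChange C t) := by
  classical
  choose q hq using hx
  let Q : Matrix ι ι K := fun i j => q i j
  refine ⟨Matrix.toLin b b Q, fun t => ?_⟩
  -- both sides are `C`-linear in `t`; compare on the basis `1 ⊗ b j`
  suffices h : x ∘ₗ β.toLinearMap = β.toLinearMap ∘ₗ (Matrix.toLin b b Q).baseChange C from
    LinearMap.congr_fun h t
  refine (Algebra.TensorProduct.basis C b).ext fun j => ?_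
  apply ((Algebra.TensorProduct.basis C b).map β).repr.injective
  refine Finsupp.ext fun i => ?_
  change ((Algebra.TensorProduct.basis C b).map β).repr (x (β (Algebra.TensorProduct.basis C b j))) i =
    ((Algebra.TensorProduct.basis C b).map β).repr
      (β ((Matrix.toLin b b Q).baseChange C (Algebra.TensorProduct.basis C b j))) i
  have lhs : ((Algebra.TensorProduct.basis C b).map β).repr (x (β (Algebra.TensorProduct.basis C b j))) i =
      algebraMap K C (q i j) := by
    rw [hq i j, Basis.map_apply]
  rw [lhs, Basis.map_repr, LinearEquiv.trans_apply, LinearEquiv.symm_apply_apply,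
    Algebra.TensorProduct.basis_apply, LinearMap.baseChange_tmul, Algebra.TensorProduct.basis_repr_tmul,
    one_smul, Finsupp.mapRange_apply]
  congr 1
  have := LinearMap.toMatrix_apply b b (Matrix.toLin b b Q) i j
  rw [LinearMap.toMatrix_toLin] at this
  exact this

end BaseChange

end Summit.HodgeConjecture.HodgeConjecture.Ring2Transport.Descent

end
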